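import Literature.Computability.AlgebraicComplexity.ArithCircuitProofs
import Literature.Computability.AlgebraicComplexity.ValiantClasses
import HarnessLib

/-!
# `VP` is closed under sums, products and scalar multiples

Robustness of Valiant's class of p-computable families (Bürgisser 2024 survey, §3.1: "all the
complexity classes introduced before are closed under `p`-projections and with respect to several
natural operations, such as taking sums, products"): for the tree's predicate `IsVPFamily`
(`ValiantClasses.lean`, Bürgisser 2000 Def. 2.4) we record closure under scalar multiples
(`IsVPFamily.C_mul`), sums (`IsVPFamily.add`), negation and differences (`IsVPFamily.neg`,
`IsVPFamily.sub`) and products (`IsVPFamily.mul`), over every commutative ring — one gate each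
(`complexity_add_le`, `complexity_mul_le`), degrees by `totalDegree_add` / `totalDegree_mul`.
Companion of `VNPClosedUnderSum.lean` (the same for `IsVNPFamily`).

## References

* P. Bürgisser, *Completeness classes in algebraic complexity theory*, arXiv:2406.06217 (2024),
  §3.1 (Robustness).
* P. Bürgisser, *Completeness and Reduction in Algebraic Complexity Theory*, Springer 2000,
  Def. 2.4, §2.1.
-/

noncomputable section

open MvPolynomial

universe u v

namespace Literature.Computability.AlgebraicComplexity

variable {k : Type u} [CommRing k] {σ : ℕ → Type v} [∀ n, Fintype (σ n)]

/-- **`VP` is closed under scalar multiples** `C (a n) · f n`. [cite: Burgisser2024Completeness, §3.1] -/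
theorem IsVPFamily.C_mul {f : ∀ n, MvPolynomial (σ n) k} (hf : IsVPFamily f) (a : ℕ → k) :
    IsVPFamily (fun n => C (a n) * f n) := by
  obtain ⟨⟨hcard, hdeg⟩, hcomp⟩ := hf
  refine ⟨⟨hcard, hdeg.mono fun n => ?_⟩, ?_⟩
  · exact (totalDegree_mul _ _).trans (by rw [totalDegree_C, zero_add])
  · refine (IsPBounded.add_holds hcomp (IsPBounded.const 1)).mono fun n => ?_
    exact (complexity_mul_le_holds _ _).trans (by rw [complexity_C_holds]; omega)

/-- **`VP` is closed under sums.** [cite: Burgisser2024Completeness, §3.1] -/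
theorem IsVPFamily.add {f g : ∀ n, MvPolynomial (σ n) k} (hf : IsVPFamily f) (hg : IsVPFamily g) :
    IsVPFamily (fun n => f n + g n) := by
  obtain ⟨⟨hcard, hdeg⟩, hcomp⟩ := hf
  obtain ⟨⟨_, hdeg'⟩, hcomp'⟩ := hg
  refine ⟨⟨hcard, (IsPBounded.add_holds hdeg hdeg').mono fun n =>
      (totalDegree_add _ _).trans (max_le (Nat.le_add_right _ _) (Nat.le_add_left _ _))⟩, ?_⟩
  exact (IsPBounded.add_holds (IsPBounded.add_holds hcomp hcomp') (IsPBounded.const 1)).mono fun n =>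
    complexity_add_le_holds _ _

/-- **`VP` is closed under products.** [cite: Burgisser2024Completeness, §3.1] -/
theorem IsVPFamily.mul {f g : ∀ n, MvPolynomial (σ n) k} (hf : IsVPFamily f) (hg : IsVPFamily g) :
    IsVPFamily (fun n => f n * g n) := by
  obtain ⟨⟨hcard, hdeg⟩, hcomp⟩ := hf
  obtain ⟨⟨_, hdeg'⟩, hcomp'⟩ := hg
  refine ⟨⟨hcard, (IsPBounded.add_holds hdeg hdeg').mono fun n => totalDegree_mul _ _⟩, ?_⟩
  exact (IsPBounded.add_holds (IsPBounded.add_holds hcomp hcomp') (IsPBounded.const 1)).mono fun n =>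
    complexity_mul_le_holds _ _

/-- **`VP` is closed under negation.** [cite: Burgisser2024Completeness, §3.1] -/
theorem IsVPFamily.neg {f : ∀ n, MvPolynomial (σ n) k} (hf : IsVPFamily f) :
    IsVPFamily (fun n => -f n) := by
  have h := hf.C_mul (fun _ => (-1 : k))
  have e : (fun n => C (-1 : k) * f n) = fun n => -f n := by
    funext n; simp
  rwa [e] at h

/-- **`VP` is closed under differences.** [cite: Burgisser2024Completeness, §3.1] -/
theorem IsVPFamily.sub {f g : ∀ n, MvPolynomial (σ n) k} (hf : IsVPFamily f) (hg : IsVPFamily g) :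
    IsVPFamily (fun n => f n - g n) := by
  have h := hf.add hg.neg
  have e : (fun n => f n + -g n) = fun n => f n - g n := by
    funext n; rw [sub_eq_add_neg]
  rwa [e] at h

end Literature.Computability.AlgebraicComplexity
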